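import Summits.QuantumFields.YangMills.Theorems.FemtoCutoffLadderWindowCoupling

/-!
# Route `FemtoCutoffLadder` — window arithmetic of MATCHED couplings at arbitrary lattice sizes: the matching identity, uniqueness
# of the matched coupling, monotonicity in the lattice size, and the two-sided coupling gap

Lead seat `ym-line-fcl-p1` g9 (2026-08-28).  Every tower argument of the route (the dyadic chains of `OctaveStepDecay` /
`DyadicNestedUpper`, the height-`k` members of `EventualTowerDominancePw`, the disprover's reading «the sequence `k ↦ z(Λ, L·2^k)`»)
uses matched window couplings `Λ(β, L) = Λ(β', L')` at two lattice sizes.  `FemtoCutoffLadderWindowCoupling` (g8) treats the octave pair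
`L = 2L'`; this file does the general pair:
* ★ `matched_identity` — `(β − β')/2 − (b₁/b₀)(log β − log β') = 2b₀ (log L − log L')` for matched positive running parameters;
* ★ `beta_eq_of_matched` — at ONE lattice size the matched window coupling is UNIQUE (`Λ(β, L) = Λ(β', L) > 0`, `β, β' ≥ 1` ⟹ `β = β'`):
  the two-loop label is strictly monotone in `β` on `β ≥ 1` because `2b₁/b₀ ≤ 1/10 < 1`;
* ★ `beta_lt_of_matched` / `matched_beta_sub` — for `L' < L` the finer lattice has the LARGER coupling, with
  `4b₀·log(L/L') ≤ β − β' ≤ (40b₀/9)·log(L/L')`;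
* `matched_same_size_trivial` — the `k = 0` (same-size) instance of every cross-multiplied femto-gap comparison holds with slack `e^{0}`.
HONEST FRAMING: real arithmetic on the tree's two-loop label; no spectral content.  R2b1 is a RECORD rung — not infinite volume, not a mass
gap, not Clay; no summit is proved by this line.  No definitions, no named facts, no `sorry`.
References: M. Lüscher, G. Münster, Nucl. Phys. B232 (1984) 445, §2 [cite: LuscherMunster1984, §2]; A. Hasenfratz, P. Hasenfratz,
Phys. Lett. 93B (1980) 165 [cite: HasenfratzHasenfratz1980, p. 165].
-/

set_option autoImplicit false

noncomputable section

namespace Summit.QuantumFields.YangMills.Theorems.FemtoCutoffLadder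

open Summit.QuantumFields.YangMills.Theorems.FemtoTransferGap

namespace WindowMatching

/-- ★ **The matching identity at arbitrary sizes**: if `(β, L)` and `(β', L')` have the same positive running parameter then
`(β − β')/2 − (b₁/b₀)(log β − log β') = 2b₀ (log L − log L')`. [cite: LuscherMunster1984, §2] -/
theorem matched_identity {β β' : ℝ} (hβ : 0 < β) (hβ' : 0 < β') {L L' : ℕ}
    (hl : 0 < luscherLambda β L) (hm : luscherLambda β L = luscherLambda β' L') :
    (β - β') / 2 - b1 / b0 * (Real.log β - Real.log β') = 2 * b0 * (Real.log (L : ℝ) - Real.log (L' : ℝ)) := by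
  have heq := WindowCoupling.invRunningCoupling_eq_of_luscherLambda_eq hl hm
  rw [BOHandover.invRunningCoupling_eq, BOHandover.invRunningCoupling_eq] at heq
  have hlog1 : Real.log (2 * b0 / β) = Real.log (2 * b0) - Real.log β :=
    Real.log_div (by unfold b0; positivity) hβ.ne'
  have hlog2 : Real.log (2 * b0 / β') = Real.log (2 * b0) - Real.log β' :=
    Real.log_div (by unfold b0; positivity) hβ'.ne'
  rw [hlog1, hlog2] at heq
  linarith

/-- The logarithm is dominated by the increment on `β' ≥ 1`: `log β − log β' ≤ β − β'` for `1 ≤ β' ≤ β`. [folklore] -/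
theorem log_sub_log_le_sub {β β' : ℝ} (hβ' : 0 < β') (hle : β' ≤ β) :
    Real.log β - Real.log β' ≤ (β - β') / β' := by
  have hβ : 0 < β := lt_of_lt_of_le hβ' hle
  have hl1 : Real.log (β / β') ≤ β / β' - 1 := Real.log_le_sub_one_of_pos (by positivity)
  rw [Real.log_div hβ.ne' hβ'.ne'] at hl1
  have hq : β / β' - 1 = (β - β') / β' := by field_simp
  linarith [hq ▸ hl1]

/-- ★ **The two-loop label is strictly monotone in `β` on `β ≥ 1`**: for `1 ≤ β' ≤ β` the left side of the matching identity is
`≥ (1/2 − b₁/b₀)(β − β') ≥ (9/20)(β − β')`. [cite: LuscherMunster1984, §2] -/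
theorem matched_lhs_ge {β β' : ℝ} (hβ'1 : 1 ≤ β') (hle : β' ≤ β) :
    (9 / 20) * (β - β') ≤ (β - β') / 2 - b1 / b0 * (Real.log β - Real.log β') := by
  have hβ'0 : 0 < β' := by linarith
  have hk0 : 0 ≤ b1 / b0 := by
    have hb0 : 0 < b0 := by unfold b0; positivity
    have hb1 : 0 < b1 := by unfold b1; positivity
    exact (div_pos hb1 hb0).le
  have hk := WindowCoupling.b1_div_b0_le
  have hlog := log_sub_log_le_sub hβ'0 hle
  have hq2 : (β - β') / β' ≤ β - β' := by
    rw [div_le_iff₀ hβ'0]; nlinarith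
  have hlogge : 0 ≤ Real.log β - Real.log β' := by
    have := Real.log_le_log hβ'0 hle; linarith
  nlinarith

/-- ★ **UNIQUENESS of the matched coupling at one lattice size**: two window couplings (`β, β' ≥ 1`) with the same positive
running parameter on the SAME lattice coincide. [cite: LuscherMunster1984, §2] -/
theorem beta_eq_of_matched {β β' : ℝ} (hβ1 : 1 ≤ β) (hβ'1 : 1 ≤ β') {L : ℕ}
    (hl : 0 < luscherLambda β L) (hm : luscherLambda β L = luscherLambda β' L) : β = β' := by
  have hβ0 : 0 < β := by linarith
  have hβ'0 : 0 < β' := by linarith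
  have hid := matched_identity hβ0 hβ'0 hl hm
  rw [sub_self, mul_zero] at hid
  rcases le_total β' β with hle | hle
  · have h := matched_lhs_ge hβ'1 hle
    nlinarith
  · have hl' : 0 < luscherLambda β' L := hm ▸ hl
    have hid' := matched_identity hβ'0 hβ0 hl' hm.symm
    rw [sub_self, mul_zero] at hid'
    have h := matched_lhs_ge hβ1 hle
    nlinarith

/-- In the femto window the matched coupling at one size is unique. [cite: LuscherMunster1984, §2] -/
theorem beta_eq_of_window {lam β β' : ℝ} {L : ℕ} (hlam : 0 < lam) (hW : InFemtoWindow lam β L)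
    (hW' : InFemtoWindow lam β' L) (hm : luscherLambda β L = luscherLambda β' L) : β = β' :=
  beta_eq_of_matched hW.1 hW'.1 (lt_of_lt_of_le hlam hW.2.1) hm

/-- ★ **Monotonicity in the lattice size**: at matched positive running parameter with `β, β' ≥ 1`, the FINER lattice (`L' < L`) carries
the strictly LARGER bare coupling `β' < β`. [cite: LuscherMunster1984, §2] -/
theorem beta_lt_of_matched {β β' : ℝ} (hβ1 : 1 ≤ β) (hβ'1 : 1 ≤ β') {L L' : ℕ} [NeZero L'] (hLL : L' < L)
    (hl : 0 < luscherLambda β L) (hm : luscherLambda β L = luscherLambda β' L') : β' < β := by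
  have hβ0 : 0 < β := by linarith
  have hβ'0 : 0 < β' := by linarith
  have hid := matched_identity hβ0 hβ'0 hl hm
  have hb0 : 0 < b0 := by unfold b0; positivity
  have hL'pos : (0 : ℝ) < (L' : ℝ) := by exact_mod_cast Nat.pos_of_ne_zero (NeZero.ne L')
  have hLL' : (L' : ℝ) < (L : ℝ) := by exact_mod_cast hLL
  have hlogpos : 0 < Real.log (L : ℝ) - Real.log (L' : ℝ) := by
    have := Real.log_lt_log hL'pos hLL'; linarith
  have hrhs : 0 < 2 * b0 * (Real.log (L : ℝ) - Real.log (L' : ℝ)) := by positivity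
  by_contra hge
  push Not at hge
  -- `β ≤ β'`: the identity read from the side of `β'` has a nonnegative left side, contradiction with the sign of the right side
  have hl' : 0 < luscherLambda β' L' := hm ▸ hl
  have hid' := matched_identity hβ'0 hβ0 hl' hm.symm
  have h := matched_lhs_ge hβ1 hge
  nlinarith

/-- ★ **The coupling gap of a matched pair at arbitrary sizes** `L' ≤ L`: `4b₀·(log L − log L') ≤ β − β' ≤ (40b₀/9)·(log L − log L')`
(the octave case `L = 2L'` is `WindowCoupling.matchedOctave_beta_sub`). [cite: LuscherMunster1984, §2] -/
theorem matched_beta_sub {β β' : ℝ} (hβ1 : 1 ≤ β) (hβ'1 : 1 ≤ β') {L L' : ℕ} [NeZero L'] (hLL : L' ≤ L)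
    (hl : 0 < luscherLambda β L) (hm : luscherLambda β L = luscherLambda β' L') :
    4 * b0 * (Real.log (L : ℝ) - Real.log (L' : ℝ)) ≤ β - β' ∧
      β - β' ≤ 40 * b0 / 9 * (Real.log (L : ℝ) - Real.log (L' : ℝ)) := by
  have hβ0 : 0 < β := by linarith
  have hβ'0 : 0 < β' := by linarith
  have hb0 : 0 < b0 := by unfold b0; positivity
  have hid := matched_identity hβ0 hβ'0 hl hm
  have hL'pos : (0 : ℝ) < (L' : ℝ) := by exact_mod_cast Nat.pos_of_ne_zero (NeZero.ne L')
  have hLL' : (L' : ℝ) ≤ (L : ℝ) := by exact_mod_cast hLL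
  have hlognn : 0 ≤ Real.log (L : ℝ) - Real.log (L' : ℝ) := by
    have := Real.log_le_log hL'pos hLL'; linarith
  -- `β' ≤ β`
  have hle : β' ≤ β := by
    rcases eq_or_lt_of_le hLL with h | h
    · subst h
      exact (beta_eq_of_matched hβ1 hβ'1 hl hm).symm.le
    · exact (beta_lt_of_matched hβ1 hβ'1 h hl hm).le
  have hk0 : 0 ≤ b1 / b0 := by
    have hb1 : 0 < b1 := by unfold b1; positivity
    exact (div_pos hb1 hb0).le
  have hlogge : 0 ≤ Real.log β - Real.log β' := by
    have := Real.log_le_log hβ'0 hle; linarith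
  have hlow := matched_lhs_ge hβ'1 hle
  constructor
  · -- drop the nonnegative logarithmic term
    nlinarith
  · -- `(9/20)(β − β') ≤ 2b₀ (log L − log L')`
    have h1 : (9 / 20) * (β - β') ≤ 2 * b0 * (Real.log (L : ℝ) - Real.log (L' : ℝ)) := by linarith
    nlinarith

/-- **The same-size instance of a cross-multiplied femto-gap comparison is trivial**: at one lattice size two matched window
couplings coincide, so `λ₁(β')^L·λ₀(β)^L ≤ e^{s}·λ₁(β)^L·λ₀(β')^L` for every `s ≥ 0` (the `k = 0` member of every dyadic chain).
[cite: LuscherMunster1984, §2] -/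
theorem matched_same_size_trivial {lam β β' s : ℝ} {L : ℕ} [NeZero L] (hlam : 0 < lam) (hs : 0 ≤ s)
    (hW : InFemtoWindow lam β L) (hW' : InFemtoWindow lam β' L) (hm : luscherLambda β L = luscherLambda β' L) :
    secondValue su2Rep L β' ^ L * topValue su2Rep L β ^ L ≤
      Real.exp s * (secondValue su2Rep L β ^ L * topValue su2Rep L β' ^ L) := by
  have hββ' := beta_eq_of_window hlam hW hW' hm
  subst hββ'
  have hnn : 0 ≤ secondValue su2Rep L β ^ L * topValue su2Rep L β ^ L :=
    mul_nonneg (pow_nonneg (secondValue_su2Rep_pos (by linarith [hW.1])).le _)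
      (pow_nonneg (topValue_su2Rep_pos L β).le _)
  calc secondValue su2Rep L β ^ L * topValue su2Rep L β ^ L
      = 1 * (secondValue su2Rep L β ^ L * topValue su2Rep L β ^ L) := (one_mul _).symm
    _ ≤ Real.exp s * (secondValue su2Rep L β ^ L * topValue su2Rep L β ^ L) :=
        mul_le_mul_of_nonneg_right (Real.one_le_exp hs) hnn

end WindowMatching

end Summit.QuantumFields.YangMills.Theorems.FemtoCutoffLadder

end
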